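import Summits.Ventures.CertifiedArithmetic.LowPrec.SRLaw
import HarnessLib

/-!
# Stochastic rounding into a finite format, XXI: kernel rows of the exact-law table (FP6)

HONEST FRAMING: certified error envelopes and provably optimal rounding/accumulation schemes for
low-precision formats under stated cost models; every table by two implementations; no hardware or
vendor claims.

Venture CertifiedArithmetic / lowprec, SR slice (gen5). Third implementation, INSIDE THE KERNEL, of
three more rows of `certs/sr/gen5/EXACT_cases_{A,B}.csv` (column `psat`), by the forward dynamic
programme of file XIX (`satProbT_eq_lawSum` + `decide +kernel` on the DP; the branch counts are
`2^15`, `2^15`, `2^31`):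

* `e3m2_saw4_seq16` — E3M2, recursive summation of the sawtooth data `1, 5/4, 3/2, 7/4, 1, …`
  (16 terms, exact sum 22 < maxRat 28): **P(sat) = 46294165 / 2^29 ≈ 0.08623** (row
  `e3m2:saw4:seq:16`; the headroom certificate of file XIII gives 1.99, vacuous);
* `e3m2_saw4_bal16` — the SAME data in the balanced (pairwise) order: **P(sat) = 0** — the pairwise
  partial sums never reach the top binade boundary on any rounding branch (row `e3m2:saw4:bal:16`);
* `e3m2_unit_bal32` — 32 ones, balanced: **P(sat) = 1** (the root adds `16 + 16 = 32 > 28` surely;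
  row `e3m2:unit:bal:32`).

So for this vector the summation ORDER moves the saturation probability from `0.086` to exactly `0`
(cf. file VIII: order as a design variable, there for the variance).
-/

namespace Summit.Ventures.CertifiedArithmetic.LowPrec.SR

open Literature.ComputerArithmetic.ConnollyHighamMary2021 Finset STree

namespace LawE3M2

/-- gen4's sawtooth test data `x_i = 1 + (i mod 4)/4`. -/
def saw4 (i : ℕ) : ℚ := 1 + ((i % 4 : ℕ) : ℚ) / 4

/-- The recursive-summation tree `((x₀ + x₁) + x₂) + ⋯ + x₁₅` of the sawtooth data (16 leaves). -/
def sawSeq16 : STree ℚ := comb (fun k => saw4 (k + 1)) (saw4 0) 15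

/-- The balanced (pairwise) tree over the same 16 leaves. -/
def sawBal16 : STree ℚ := balT saw4 0 4

/-- Both trees carry the same data: exact sum `22`, 16 leaves. -/
theorem saw16_exact : sawSeq16.exact = 22 ∧ sawBal16.exact = 22 ∧
    sawSeq16.leaves = 16 ∧ sawBal16.leaves = 16 := by
  decide +kernel

/-- **Row `e3m2:saw4:seq:16`: P(sat) = 46294165 / 2^29** (kernel DP). -/
theorem e3m2_saw4_seq16 : satProbT Formats.e3m2 sawSeq16 = 46294165 / 536870912 := by
  obtain ⟨hlo, hhi, _, hb⟩ := e3m2_hull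
  rw [satProbT_eq_lawSum hlo hhi hb]
  decide +kernel

/-- **Row `e3m2:saw4:bal:16`: P(sat) = 0** — the pairwise order never saturates on this data. -/
theorem e3m2_saw4_bal16 : satProbT Formats.e3m2 sawBal16 = 0 := by
  obtain ⟨hlo, hhi, _, hb⟩ := e3m2_hull
  rw [satProbT_eq_lawSum hlo hhi hb]
  decide +kernel

/-- **Row `e3m2:unit:bal:32`: P(sat) = 1** — 32 ones in balanced order saturate surely. -/
theorem e3m2_unit_bal32 : satProbT Formats.e3m2 (balT (fun _ => (1 : ℚ)) 0 5) = 1 := by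
  obtain ⟨hlo, hhi, _, hb⟩ := e3m2_hull
  rw [satProbT_eq_lawSum hlo hhi hb]
  decide +kernel

end LawE3M2

end Summit.Ventures.CertifiedArithmetic.LowPrec.SR
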